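import Mathlib
import HarnessLib
import Summits.Langlands.Statement
import Summits.Langlands.Langlands.Theses.PrimeSwitchSplit
import Summits.Langlands.Langlands.Theorems.FrobeniusAlgebraicityCarving

/-!
# `FrobeniusUnitCarving` — lens-6 (barrier-complement carving), decomp-langlands g33 — CENSUS TWIN, PART 1 of 2 (texts · dial `HasUnitFrobenius` · kernel helpers I–II: compact-image unit lemma, finite-order and compatible-family engines, bridge to g32; part 2 = `FrobeniusUnitCarvingKernel`: local–global helpers · cells · closes_host · necessity · rungs) of the ROOT-depth node

This file is the node `HOME/nodes/lens-6-g33-FrobeniusUnitCarving.lean` with its namespace moved from `…Theses.FrobeniusUnitCarving` to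
`…Theorems.FrobeniusUnitCarving`, the `#print axioms` guards removed (they live in the node file) and the registry-owned name `closes` renamed
`closes_host`.  No `sorry`.  Supports stmt-Langlands-17414 (context for the queued child route FrobeniusUnitCarving; the route decls will be
verbatim copies of `FrobeniusUnits` / `UnitWeakAutomorphy` below, so `Iff.rfl` bridges them after birth).

A ROOT-depth carving node one layer UNDER g32's `FrobeniusAlgebraicityCarving`: target the weak-automorphy crux
`B_w := Summit.Langlands.Langlands.Theses.PrimeSwitchSplit.WeakGeometricAutomorphy` (stmt-Langlands-17414, crux r2 of the served host route
`PrimeSwitchSplit`) BY NAME, and — by name as well — g32's residual `ArithmeticWeakAutomorphy` (tree decl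
`Summit.Langlands.Langlands.Theorems.FrobeniusAlgebraicityCarving.ArithmeticWeakAutomorphy`, census twin p823455).

DIAL (new on `B_w`): the NON-ARCHIMEDEAN AVATAR SIZES of the Frobenius roots.  For `ρ : Γ_K → GL_n(ℚ̄_ℓ)` seen through `ι : ℚ̄_ℓ ≃ ℂ`,
`HasUnitFrobenius K ℓ ι ρ` := «for almost every place `v`, every root `β` of every Frobenius characteristic polynomial of `ρ` at `v` and every
OTHER avatar `ι' : ℚ̄_{ℓ'} ≃ ℂ` with `v ∤ ℓ'`: `‖ι'⁻¹(ι β)‖_{ℓ'} = 1`» — every `ℓ'`-adic avatar of a Frobenius root is an `ℓ'`-adic UNIT away from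
the residue characteristic (Deligne's integrality «`α` is a `p_v`-unit at all `λ ∤ p_v`», the third of the four properties Fontaine–Mazur predicts;
the archimedean sizes are g30/g31's window, algebraicity is g32's `FrobeniusAlgebraicity`, which this dial IMPLIES in kernel, `fa_of_fu`).
Pieces (B_w binder prefix VERBATIM, one anchored edit each):
* FU  `FrobeniusUnits` (crux r2, DECIDING, GALOIS + AVATARS ONLY, level-free): every irreducible geometric `ρ` has unit Frobenius avatars a.e.;
* UWA `UnitWeakAutomorphy` (residual r3): `B_w` VERBATIM on the `ρ` with unit Frobenius avatars (ONE inserted hypothesis);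
* NUWA `NonUnitWeakAutomorphy` (node-only complement): `B_w` on the rest — CERTIFIED S-VOID (`nuwa_of_fu`).

KERNEL CERTIFICATES (part 2 `FrobeniusUnitCarvingKernel`; node `lean check` rc 0, 0 sorry; axioms propext / Classical.choice / Quot.sound, guards in the node file):
`closes_host : FU → UWA → B_w` · `closes_awa : FU → UWA → AWA(g32)` (this node refines g32's residual by name) · `closes_root : FU → UWA → W⁺ → P → A →
R → Langlands` (via `PrimeSwitchSplit.closes` + `AvatarConjugacy_holds`) · EXACTNESS `weakAut_iff_cells : B_w ↔ UWA ∧ NUWA`, `nuwa_of_fu` ·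
`uwa_of_awa : AWA → UWA` (the new residual is WEAKER than g32's) · `fa_of_fu : FU → FA` (the new crux is STRONGER than g32's: unit avatars at
the two primes 2, 3 already force algebraicity, Steinitz — `LArithmeticOfAutToGal.isAlgebraic_of_forall_norm_symm_le_one`) · NECESSITY EXACT IN
KERNEL: `fu_of_dirA_of_weakAut : (A) → B_w → FU` and `fu_of_langlands : Langlands → FU` — B_w gives `π`, direction (A) at EVERY OTHER prime `ℓ'`
and avatar `ι'` gives `ρ' = ρ_{π,ι'}`, local–global compatibility at `v ∤ ℓ'` puts `ι'⁻¹(a)` into the spectrum of `ρ'` at a Frobenius (rank ≥ 2: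
the tree's unconditional unramified `rec_v` computation; rank 1: `stub_rankOne_corresponds_away_unramified`, PROVED), and the NEW LEMMA
`FramedRep.norm_eq_one_of_isRoot_charpoly` (eigenvalues of a COMPACT-image representation are UNITS: all `≤ 1` and their product, a value of the
continuous determinant character, has norm 1 — the tree had only `≤ 1`) makes it a unit · RUNGS PROVED: `finiteOrderUnitRung` (finite-order `ρ`:
roots of unity), `compatibleFamilyUnitRung` (every member of a FULL COMPATIBLE FAMILY — an `ℓ'`-adic companion for every `ℓ'`, `ι'` with matching
Frobenius polynomials in `ℂ` off a fixed finite set — has unit Frobenius avatars: «Frobenius eigenvalues of compatible systems are `p`-units»,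
the regime of ALL of étale cohomology, where `B_w` is wide open — a separating BC5 witness with S-case `CompatibleFamilyCase`).
-/

set_option linter.dupNamespace false -- project-wide option (lakefile weak.linter.dupNamespace); `Summit.Langlands.Langlands` is the mandated namespace

namespace Summit.Langlands.Langlands.Theorems.FrobeniusUnitCarving

open Filter Polynomial
open scoped NumberField
open Summit.Langlands.Langlands.Theorems.FrobeniusAlgebraicityCarving (FrobeniusAlgebraicity ArithmeticWeakAutomorphy ArtinCase
  HasAlgebraicFrobenius isAlgebraic_symm exists_eq_charpoly_of_hasFrobCharpolyAt)

/-! ## Route texts (one-line Props over accepted declarations; the `B_w` binder prefix VERBATIM, ONE anchored edit each) -/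

/-- crux (rank 2, DECIDING, NEW, GALOIS + AVATARS ONLY, LEVEL-FREE): **FROBENIUS UNITS** — for every number field `K`, every `n ≥ 1`, every
prime `ℓ`, every `ι : ℚ̄_ℓ ≃ ℂ` and every IRREDUCIBLE GEOMETRIC `ρ : Γ_K → GL_n(ℚ̄_ℓ)` (a.e. unramified, de Rham above `ℓ` for the pinned Fontaine
data — the `B_w` prefix verbatim minus the level `hcpt`), for almost every place `v`: every root `β` of every Frobenius characteristic polynomial
of `ρ` at `v` is an `ℓ'`-ADIC UNIT IN EVERY OTHER AVATAR, `‖ι'⁻¹(ι β)‖ = 1` for all primes `ℓ'` with `v ∤ ℓ'` and all `ι' : ℚ̄_{ℓ'} ≃ ℂ`.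
S-implied in kernel (`fu_of_langlands`); implies g32's `FrobeniusAlgebraicity` (`fa_of_fu`); with `UnitWeakAutomorphy` it gives `B_w` (`closes_host`).
WHY IT MIGHT FAIL: it is Deligne's `λ`-adic integrality for an ARBITRARY irreducible de Rham `ρ`, known only on the abelian / Artin /
compatible-family (étale cohomology) / potentially automorphic sectors: ONE irreducible de Rham `ρ` (even, irregular, `n ≥ 2`) with a Frobenius
root of non-zero `λ`-valuation at some `λ ∤ p_v` for infinitely many `v` refutes it — and with it `B_w` given (A), and `Langlands`.
SOURCES: Taylor arXiv:math/0212403 p.5 (Conj. 1 Fontaine–Mazur, Conj. 3, «α is algebraic and … a unit at λ ∤ p»); Deligne, Weil II (1980)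
3.3.1 / SGA 7 XXI; FontaineMazur1995 Conj. 1; Calegari arXiv:2109.14145 §1.1; Serre 1968 Ch. I §2.3 (rational / integral ℓ-adic representations);
tree `Theorems.lArithmeticOfAutToGal_proof` (stmt-1066, p819419) and `CompactImageCharpolyIntegral` (`≤ 1`). [conjecture] -/
def FrobeniusUnits : Prop :=
  ∀ (K : Type) [Field K] [NumberField K] (n : ℕ), 0 < n → ∀ (ℓ : ℕ) [Fact ℓ.Prime] (ι : PadicAlgCl ℓ ≃+* ℂ) (ρ : Literature.NumberTheory.GaloisRepresentations.FramedGaloisRep K (PadicAlgCl ℓ) n), ρ.toGaloisRep.IsIrreducible → ((∀ᶠ v : IsDedekindDomain.HeightOneSpectrum (NumberField.RingOfIntegers K) in cofinite, ρ.IsUnramifiedAt v) ∧ ∀ (v : IsDedekindDomain.HeightOneSpectrum (NumberField.RingOfIntegers K)) (hv : ((ℓ : ℕ) : NumberField.RingOfIntegers K) ∈ v.asIdeal), (Literature.NumberTheory.PAdicHodge.fontainePstAdicCompletion v ℓ hv).IsDeRhamFramed (ρ.toLocal v)) → ∀ᶠ v : IsDedekindDomain.HeightOneSpectrum (NumberField.RingOfIntegers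 K) in Filter.cofinite, ∀ P : Polynomial (PadicAlgCl ℓ), ρ.HasFrobCharpolyAt v P → ∀ β ∈ P.roots, ∀ (ℓ' : ℕ) [Fact ℓ'.Prime] (ι' : PadicAlgCl ℓ' ≃+* ℂ), ((ℓ' : ℕ) : NumberField.RingOfIntegers K) ∉ v.asIdeal → ‖ι'.symm (ι β)‖ = 1

/-- residual (rank 3, WEAKER, S-implied `uwa_of_target`, DECLARED RESIDUAL — every automorphy engine lives here): **UNIT WEAK AUTOMORPHY** —
`B_w` VERBATIM on the `ρ` whose Frobenius roots are units in every other avatar at almost every place (ONE inserted hypothesis after the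
geometricity clause).  WEAKER than g32's residual: `uwa_of_awa : ArithmeticWeakAutomorphy → UnitWeakAutomorphy` (kernel).  Every
automorphy-lifting / potential-automorphy engine and every catalogued barrier of `Literature/Barriers/Langlands` quantifies over data living in
THIS cell.  WHY IT MIGHT FAIL: it is Fontaine–Mazur–Langlands for `GL_n` over every number field minus a cell FU predicts empty — open for even /
irregular / non-CM-base `ρ`.  SOURCES: Calegari arXiv:2109.14145; ACC⁺ arXiv:1812.09999 Thm 6.1.1; BLGGT 2014 Thm 4.5.1; tree
`PrimeSwitchSplit.WeakGeometricAutomorphy` (stmt-17414), `Theorems.FrobeniusAlgebraicityCarving.ArithmeticWeakAutomorphy` (g32). [conjecture] -/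
def UnitWeakAutomorphy : Prop :=
  ∀ (K : Type) [Field K] [NumberField K] (n : ℕ) (hcpt : Literature.NumberTheory.Automorphic.isCompact_glFiniteIntegralLevel n K), 0 < n → ∀ (ℓ : ℕ) [Fact ℓ.Prime] (ι : PadicAlgCl ℓ ≃+* ℂ) (ρ : Literature.NumberTheory.GaloisRepresentations.FramedGaloisRep K (PadicAlgCl ℓ) n), ρ.toGaloisRep.IsIrreducible → ((∀ᶠ v : IsDedekindDomain.HeightOneSpectrum (NumberField.RingOfIntegers K) in cofinite, ρ.IsUnramifiedAt v) ∧ ∀ (v : IsDedekindDomain.HeightOneSpectrum (NumberField.RingOfIntegers K)) (hv : ((ℓ : ℕ) : NumberField.RingOfIntegers K) ∈ v.asIdeal), (Literature.NumberTheory.PAdicHodge.fontainePstAdicCompletion v ℓ hv).IsDeRhamFramed (ρ.toLocal v)) → (∀ᶠ v : IsDedekindDomain.HeightOneSpectrum (NumberField.RingOfIntegers K) in Filter.cofinite, ∀ P : Polynomial (PadicAlgCl ℓ), ρ.HasFrobCharpolyAt v P → ∀ β ∈ P.roots, ∀ (ℓ' : ℕ) [Fact ℓ'.Prime] (ι' :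 PadicAlgCl ℓ' ≃+* ℂ), ((ℓ' : ℕ) : NumberField.RingOfIntegers K) ∉ v.asIdeal → ‖ι'.symm (ι β)‖ = 1) → ∃ π : Literature.NumberTheory.Automorphic.CuspidalAutomorphicRepData n K hcpt, π.1.IsLAlgebraic ∧ ∀ᶠ v : IsDedekindDomain.HeightOneSpectrum (NumberField.RingOfIntegers K) in cofinite, SatakeFrobCompatibleAt ι π.1 ρ v

/-- complement cell (node-only, NOT a route item): **NON-UNIT WEAK AUTOMORPHY** — `B_w` on the `ρ` violating the unit clause.  CERTIFIED
S-VOID: `nuwa_of_fu : FrobeniusUnits → NonUnitWeakAutomorphy` (the class is EMPTY under FU, and FU is S-implied in kernel). [conjecture] -/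
def NonUnitWeakAutomorphy : Prop :=
  ∀ (K : Type) [Field K] [NumberField K] (n : ℕ) (hcpt : Literature.NumberTheory.Automorphic.isCompact_glFiniteIntegralLevel n K), 0 < n → ∀ (ℓ : ℕ) [Fact ℓ.Prime] (ι : PadicAlgCl ℓ ≃+* ℂ) (ρ : Literature.NumberTheory.GaloisRepresentations.FramedGaloisRep K (PadicAlgCl ℓ) n), ρ.toGaloisRep.IsIrreducible → ((∀ᶠ v : IsDedekindDomain.HeightOneSpectrum (NumberField.RingOfIntegers K) in cofinite, ρ.IsUnramifiedAt v) ∧ ∀ (v : IsDedekindDomain.HeightOneSpectrum (NumberField.RingOfIntegers K)) (hv : ((ℓ : ℕ) : NumberField.RingOfIntegers K) ∈ v.asIdeal), (Literature.NumberTheory.PAdicHodge.fontainePstAdicCompletion v ℓ hv).IsDeRhamFramed (ρ.toLocal v)) → ¬ (∀ᶠ v : IsDedekindDomain.HeightOneSpectrum (NumberField.RingOfIntegers K) in Filter.cofinite, ∀ P : Polynomial (PadicAlgCl ℓ), ρ.HasFrobCharpolyAt v P → ∀ β ∈ P.roots, ∀ (ℓ' : ℕ) [Fact ℓ'.Prime]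 (ι' : PadicAlgCl ℓ' ≃+* ℂ), ((ℓ' : ℕ) : NumberField.RingOfIntegers K) ∉ v.asIdeal → ‖ι'.symm (ι β)‖ = 1) → ∃ π : Literature.NumberTheory.Automorphic.CuspidalAutomorphicRepData n K hcpt, π.1.IsLAlgebraic ∧ ∀ᶠ v : IsDedekindDomain.HeightOneSpectrum (NumberField.RingOfIntegers K) in cofinite, SatakeFrobCompatibleAt ι π.1 ρ v

/-- node-local: the Assembly of this node (`closes_host`). [new] (node-local statement; re-tagged from the kit's «folklore» at landing — gate: folklore now covers only private helpers / plumbing) -/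
def ChildAssembly : Prop :=
  FrobeniusUnits → UnitWeakAutomorphy → Summit.Langlands.Langlands.Theses.PrimeSwitchSplit.WeakGeometricAutomorphy

/-! ## Rung and S-case texts (BC5 / t3) -/

/-- rung of FU (PROVED, `finiteOrderUnitRung`): FU on FINITE-ORDER `ρ` — every Frobenius root is a root of unity, a unit in every avatar.
Its S-case is g32's `ArtinCase` (tree decl, = `B_w` on finite-order `ρ` = strong Artin; NOT a theorem). [new] (node-local statement; re-tagged from the kit's «folklore» at landing — gate: folklore now covers only private helpers / plumbing) -/
def FiniteOrderUnitRung : Prop :=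
  ∀ (K : Type) [Field K] [NumberField K] (n : ℕ), 0 < n → ∀ (ℓ : ℕ) [Fact ℓ.Prime] (ι : PadicAlgCl ℓ ≃+* ℂ) (ρ : Literature.NumberTheory.GaloisRepresentations.FramedGaloisRep K (PadicAlgCl ℓ) n), ρ.toGaloisRep.IsIrreducible → (∃ k : ℕ, 0 < k ∧ ∀ σ : Field.absoluteGaloisGroup K, ρ σ ^ k = 1) → ((∀ᶠ v : IsDedekindDomain.HeightOneSpectrum (NumberField.RingOfIntegers K) in cofinite, ρ.IsUnramifiedAt v) ∧ ∀ (v : IsDedekindDomain.HeightOneSpectrum (NumberField.RingOfIntegers K)) (hv : ((ℓ : ℕ) : NumberField.RingOfIntegers K) ∈ v.asIdeal), (Literature.NumberTheory.PAdicHodge.fontainePstAdicCompletion v ℓ hv).IsDeRhamFramed (ρ.toLocal v)) → ∀ᶠ v : IsDedekindDomain.HeightOneSpectrum (NumberField.RingOfIntegers K) in Filter.cofinite, ∀ P : Polynomial (PadicAlgCl ℓ), ρ.HasFrobCharpolyAt v P → ∀ β ∈ P.roots, ∀ (ℓ' : ℕ) [Fact ℓ'.Prime] (ι' : PadicAlgCl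 ℓ' ≃+* ℂ), ((ℓ' : ℕ) : NumberField.RingOfIntegers K) ∉ v.asIdeal → ‖ι'.symm (ι β)‖ = 1

/-- rung of FU (PROVED, `compatibleFamilyUnitRung`): FU on every `ρ` that is (through `ι`) a member of a FULL COMPATIBLE FAMILY with a fixed
finite exceptional set `S` — for every prime `ℓ'` and avatar `ι'` an `ℓ'`-adic `ρ'` whose Frobenius polynomials at `v ∉ S`, `v ∤ ℓ'` agree IN `ℂ`
with those of `ρ`.  This is the regime of the étale cohomology of every smooth projective variety (and of every known motivic / automorphic
Galois representation), where `B_w` (S-case `CompatibleFamilyCase`) is wide open. [new] (node-local statement; re-tagged from the kit's «folklore» at landing — gate: folklore now covers only private helpers / plumbing) -/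
def CompatibleFamilyUnitRung : Prop :=
  ∀ (K : Type) [Field K] [NumberField K] (n : ℕ), 0 < n → ∀ (ℓ : ℕ) [Fact ℓ.Prime] (ι : PadicAlgCl ℓ ≃+* ℂ) (ρ : Literature.NumberTheory.GaloisRepresentations.FramedGaloisRep K (PadicAlgCl ℓ) n), ρ.toGaloisRep.IsIrreducible → (∃ S : Set (IsDedekindDomain.HeightOneSpectrum (NumberField.RingOfIntegers K)), S.Finite ∧ ∀ (ℓ' : ℕ) [Fact ℓ'.Prime] (ι' : PadicAlgCl ℓ' ≃+* ℂ), ∃ ρ' : Literature.NumberTheory.GaloisRepresentations.FramedGaloisRep K (PadicAlgCl ℓ') n, ∀ v ∉ S, ((ℓ' : ℕ) : NumberField.RingOfIntegers K) ∉ v.asIdeal → ∀ P : Polynomial (PadicAlgCl ℓ), ρ.HasFrobCharpolyAt v P → ∃ P' : Polynomial (PadicAlgCl ℓ'), ρ'.HasFrobCharpolyAt v P' ∧ P'.map (ι' : PadicAlgCl ℓ' →+* ℂ) = P.map (ι : PadicAlgCl ℓ →+* ℂ)) → ((∀ᶠ v : IsDedekindDomain.HeightOneSpectrum (NumberField.RingOfIntegers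 K) in cofinite, ρ.IsUnramifiedAt v) ∧ ∀ (v : IsDedekindDomain.HeightOneSpectrum (NumberField.RingOfIntegers K)) (hv : ((ℓ : ℕ) : NumberField.RingOfIntegers K) ∈ v.asIdeal), (Literature.NumberTheory.PAdicHodge.fontainePstAdicCompletion v ℓ hv).IsDeRhamFramed (ρ.toLocal v)) → ∀ᶠ v : IsDedekindDomain.HeightOneSpectrum (NumberField.RingOfIntegers K) in Filter.cofinite, ∀ P : Polynomial (PadicAlgCl ℓ), ρ.HasFrobCharpolyAt v P → ∀ β ∈ P.roots, ∀ (ℓ' : ℕ) [Fact ℓ'.Prime] (ι' : PadicAlgCl ℓ' ≃+* ℂ), ((ℓ' : ℕ) : NumberField.RingOfIntegers K) ∉ v.asIdeal → ‖ι'.symm (ι β)‖ = 1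

/-- S-case of the compatible-family rung (t3): `B_w` on members of full compatible families = automorphy of compatible systems (Taylor 2004
Conj. 3 ⇒ Conj. 1 direction is automorphy of all of étale cohomology); NOT a theorem in the tree (compare `CompatibleFamilySplit.CompatibleFamilyAutomorphy`,
a differently-typed sibling). [conjecture] -/
def CompatibleFamilyCase : Prop :=
  ∀ (K : Type) [Field K] [NumberField K] (n : ℕ) (hcpt : Literature.NumberTheory.Automorphic.isCompact_glFiniteIntegralLevel n K), 0 < n → ∀ (ℓ : ℕ) [Fact ℓ.Prime] (ι : PadicAlgCl ℓ ≃+* ℂ) (ρ : Literature.NumberTheory.GaloisRepresentations.FramedGaloisRep K (PadicAlgCl ℓ) n), ρ.toGaloisRep.IsIrreducible → (∃ S : Set (IsDedekindDomain.HeightOneSpectrum (NumberField.RingOfIntegers K)), S.Finite ∧ ∀ (ℓ' : ℕ) [Fact ℓ'.Prime] (ι' : PadicAlgCl ℓ' ≃+* ℂ), ∃ ρ' : Literature.NumberTheory.GaloisRepresentations.FramedGaloisRep K (PadicAlgCl ℓ') n, ∀ v ∉ S, ((ℓ' : ℕ) : NumberField.RingOfIntegers K) ∉ v.asIdeal → ∀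 P : Polynomial (PadicAlgCl ℓ), ρ.HasFrobCharpolyAt v P → ∃ P' : Polynomial (PadicAlgCl ℓ'), ρ'.HasFrobCharpolyAt v P' ∧ P'.map (ι' : PadicAlgCl ℓ' →+* ℂ) = P.map (ι : PadicAlgCl ℓ →+* ℂ)) → ((∀ᶠ v : IsDedekindDomain.HeightOneSpectrum (NumberField.RingOfIntegers K) in cofinite, ρ.IsUnramifiedAt v) ∧ ∀ (v : IsDedekindDomain.HeightOneSpectrum (NumberField.RingOfIntegers K)) (hv : ((ℓ : ℕ) : NumberField.RingOfIntegers K) ∈ v.asIdeal), (Literature.NumberTheory.PAdicHodge.fontainePstAdicCompletion v ℓ hv).IsDeRhamFramed (ρ.toLocal v)) → ∃ π : Literature.NumberTheory.Automorphic.CuspidalAutomorphicRepData n K hcpt, π.1.IsLAlgebraic ∧ ∀ᶠ v : IsDedekindDomain.HeightOneSpectrum (NumberField.RingOfIntegers K) in cofinite, SatakeFrobCompatibleAt ι π.1 ρ v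

/-! ## The dial, named per representation -/

section Dial

open IsDedekindDomain NumberField Literature.NumberTheory.GaloisRepresentations Literature.NumberTheory.Automorphic

variable (K : Type) [Field K] [NumberField K] (ℓ : ℕ) [Fact ℓ.Prime]

/-- `ρ` (seen through `ι`) HAS UNIT FROBENIUS AVATARS at almost every place (the FU conclusion, literally). [new] (node-local statement; re-tagged from the kit's «folklore» at landing — gate: folklore now covers only private helpers / plumbing) -/
def HasUnitFrobenius {n : ℕ} (ι : PadicAlgCl ℓ ≃+* ℂ) (ρ : FramedGaloisRep K (PadicAlgCl ℓ) n) : Prop :=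
  ∀ᶠ v : IsDedekindDomain.HeightOneSpectrum (NumberField.RingOfIntegers K) in Filter.cofinite, ∀ P : Polynomial (PadicAlgCl ℓ), ρ.HasFrobCharpolyAt v P → ∀ β ∈ P.roots, ∀ (ℓ' : ℕ) [Fact ℓ'.Prime] (ι' : PadicAlgCl ℓ' ≃+* ℂ), ((ℓ' : ℕ) : NumberField.RingOfIntegers K) ∉ v.asIdeal → ‖ι'.symm (ι β)‖ = 1

variable {K ℓ}

/-! ### Kernel helpers, I: eigenvalues of compact-image representations are UNITS -/

section CompactImage

open scoped Matrix MatrixGroups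

/-! Re-proofs (suffix `_fu`, PRIVATE — gate dedup.landed: the canonical statements live in the unbuilt Literature module; same device as the private `_lar` copies
in `LiftDescendLArithmeticOfAutToGal`; delete once that module is built on the farm) of the `≤ 1` half from the tree's `Literature.NumberTheory.GaloisRepresentations.CompactImageCharpolyIntegral`
(`FramedRep.norm_le_one_of_isRoot_charpoly`, Serre 1968 Ch. I §1.1), which is not in this file's import closure (the 1066 proof file re-proves
it privately for the same reason); then the NEW `= 1` half by the determinant. -/

variable {A : Type*} [NormedField A] {m : Type*} [Fintype m] [DecidableEq m]

omit [DecidableEq m] in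
/-- entrywise bound ⇒ sup-norm operator bound. [folklore] -/
private theorem norm_mulVec_le_of_forall_norm_le_fu {N : Matrix m m A} {C : ℝ} (hC : 0 ≤ C)
    (h : ∀ i j, ‖N i j‖ ≤ C) (w : m → A) :
    ‖N *ᵥ w‖ ≤ Fintype.card m * C * ‖w‖ := by
  refine (pi_norm_le_iff_of_nonneg (by positivity)).mpr fun i => ?_
  calc ‖(N *ᵥ w) i‖ = ‖∑ j, N i j * w j‖ := rfl
    _ ≤ ∑ j, ‖N i j * w j‖ := norm_sum_le _ _
    _ ≤ ∑ _j : m, C * ‖w‖ := Finset.sum_le_sum fun j _ => by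
        rw [norm_mul]
        exact mul_le_mul (h i j) (norm_le_pi_norm w j) (norm_nonneg _) hC
    _ = Fintype.card m * C * ‖w‖ := by
        rw [Finset.sum_const, Finset.card_univ, nsmul_eq_mul]
        ring

/-- powers act on an eigenvector by powers of the eigenvalue. [folklore] -/
private theorem pow_mulVec_eq_pow_smul_fu {N : Matrix m m A} {μ : A} {v : m → A} (hv : N *ᵥ v = μ • v)
    (k : ℕ) : (N ^ k) *ᵥ v = μ ^ k • v := by
  induction k with
  | zero => simp
  | succ k ih =>
    rw [pow_succ, ← Matrix.mulVec_mulVec, hv, Matrix.mulVec_smul, ih, smul_smul, ← pow_succ']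

/-- eigenvalues of a power-bounded matrix have norm `≤ 1`. [folklore] -/
private theorem norm_le_one_of_isRoot_charpoly_of_pow_bounded_fu {N : Matrix m m A} {C : ℝ}
    (hC : ∀ k : ℕ, ∀ i j, ‖(N ^ k) i j‖ ≤ C) {μ : A} (hμ : N.charpoly.IsRoot μ) : ‖μ‖ ≤ 1 := by
  have hev : Module.End.HasEigenvalue (Matrix.toLin' N) μ := by
    rw [Module.End.hasEigenvalue_iff_isRoot_charpoly, Matrix.charpoly_toLin']
    exact hμ
  obtain ⟨v, hv⟩ := hev.exists_hasEigenvector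
  have hv0 : v ≠ 0 := hv.2
  have hNv : N *ᵥ v = μ • v := by
    have h := hv.apply_eq_smul
    rwa [Matrix.toLin'_apply] at h
  have hvpos : 0 < ‖v‖ := norm_pos_iff.mpr hv0
  have hm : Nonempty m := by
    by_contra h
    rw [not_nonempty_iff] at h
    exact hv0 (Subsingleton.elim _ _)
  obtain ⟨i₀⟩ := hm
  have hC0 : 0 ≤ C := (norm_nonneg _).trans (hC 0 i₀ i₀)
  have hbound : ∀ k : ℕ, ‖μ‖ ^ k ≤ Fintype.card m * C := by
    intro k
    have h1 : ‖(N ^ k) *ᵥ v‖ ≤ Fintype.card m * C * ‖v‖ :=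
      norm_mulVec_le_of_forall_norm_le_fu hC0 (hC k) v
    rw [pow_mulVec_eq_pow_smul_fu hNv, norm_smul, norm_pow] at h1
    exact le_of_mul_le_mul_right h1 hvpos
  by_contra hlt
  rw [not_le] at hlt
  obtain ⟨k, hk⟩ := pow_unbounded_of_one_lt (Fintype.card m * C) hlt
  exact absurd (hbound k) (not_le.mpr hk)

/-- **an eigenvalue of a matrix of finite order is a root of unity**: `M ^ k = 1`, `β ∈ roots (charpoly M)` ⇒ `β ^ k = 1` (spectral mapping). [folklore] -/
theorem pow_eq_one_of_mem_roots_charpoly_of_pow_eq_one {K' : Type*} [Field K'] {d k : ℕ} {M : Matrix (Fin d) (Fin d) K'} (hM : M ^ k = 1)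
    {β : K'} (hβ : β ∈ M.charpoly.roots) : β ^ k = 1 := by
  classical
  rcases Nat.eq_zero_or_pos d with hd0 | hdpos
  · exfalso
    subst hd0
    have h1 : M.charpoly = 1 := by unfold Matrix.charpoly; exact Matrix.det_isEmpty
    rw [h1, Polynomial.roots_one] at hβ
    exact Multiset.notMem_zero _ hβ
  haveI : Nonempty (Fin d) := ⟨⟨0, hdpos⟩⟩
  have hroot : Polynomial.IsRoot M.charpoly β := Polynomial.isRoot_of_mem_roots hβ
  have hspec : β ∈ spectrum K' M := Matrix.mem_spectrum_of_isRoot_charpoly hroot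
  have hspeck : β ^ k ∈ spectrum K' (M ^ k) := spectrum.pow_mem_pow M k hspec
  rw [hM, ← map_one (algebraMap K' (Matrix (Fin d) (Fin d) K')), spectrum.scalar_eq, Set.mem_singleton_iff] at hspeck
  exact hspeck

variable {G : Type*} [Group G] [TopologicalSpace G] [CompactSpace G] {d : ℕ}

/-- matrix entries of a continuous representation of a COMPACT group are uniformly bounded. [folklore] -/
theorem FramedRep.exists_forall_norm_apply_le_fu (ρ : FramedRep G A d) :
    ∃ C : ℝ, ∀ (g : G) (i j : Fin d), ‖((ρ g : GL (Fin d) A) : Matrix (Fin d) (Fin d) A) i j‖ ≤ C := by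
  set f : G → (Fin d → Fin d → A) :=
    fun g i j => ((ρ g : GL (Fin d) A) : Matrix (Fin d) (Fin d) A) i j with hf_def
  have hf : Continuous f := by
    refine continuous_pi fun i => continuous_pi fun j => ?_
    exact (Units.continuous_val.comp (map_continuous ρ)).matrix_elem i j
  obtain ⟨C, hC⟩ := isCompact_univ.exists_bound_of_continuousOn hf.continuousOn
  refine ⟨C, fun g i j => ?_⟩
  exact ((norm_le_pi_norm (f g i) j).trans (norm_le_pi_norm (f g) i)).trans (hC g (Set.mem_univ g))

/-- every eigenvalue of `ρ(g)` has norm `≤ 1` (compact `G`). Serre 1968, Ch. I §1.1. [folklore] -/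
theorem FramedRep.norm_le_one_of_isRoot_charpoly_fu (ρ : FramedRep G A d) (g : G) {μ : A}
    (hμ : (FramedRep.charpoly ρ g).IsRoot μ) : ‖μ‖ ≤ 1 := by
  obtain ⟨C, hC⟩ := FramedRep.exists_forall_norm_apply_le_fu ρ
  refine norm_le_one_of_isRoot_charpoly_of_pow_bounded_fu
    (N := ((ρ g : GL (Fin d) A) : Matrix (Fin d) (Fin d) A)) (C := C) (fun k i j => ?_) hμ
  have h : ((ρ g : GL (Fin d) A) : Matrix (Fin d) (Fin d) A) ^ k =
      ((ρ (g ^ k) : GL (Fin d) A) : Matrix (Fin d) (Fin d) A) := by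
    rw [map_pow, Units.val_pow_eq_pow_val]
  rw [h]
  exact hC (g ^ k) i j

omit [Fintype m] [DecidableEq m] in
/-- a multiset of elements of norm `≤ 1` has a product of norm `≤ 1`. [folklore] -/
theorem norm_multiset_prod_le_one (s : Multiset A) (h : ∀ x ∈ s, ‖x‖ ≤ 1) : ‖s.prod‖ ≤ 1 := by
  induction s using Multiset.induction_on with
  | empty => simp
  | cons a s ih =>
    rw [Multiset.prod_cons, norm_mul]
    exact mul_le_one₀ (h a (Multiset.mem_cons_self a s)) (norm_nonneg _)
      (ih fun x hx => h x (Multiset.mem_cons_of_mem hx))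

variable [IsAlgClosed A]

/-- **the determinant of `ρ(g)` has norm exactly `1`** (compact `G`, algebraically closed coefficients): `‖det ρ(g)‖ ≤ 1` and `‖det ρ(g⁻¹)‖ ≤ 1`
(products of eigenvalues of norm `≤ 1`) with product `1`. [folklore] -/
theorem FramedRep.norm_det_eq_one (ρ : FramedRep G A d) (g : G) :
    ‖((ρ g : GL (Fin d) A) : Matrix (Fin d) (Fin d) A).det‖ = 1 := by
  have hle : ∀ h : G, ‖((ρ h : GL (Fin d) A) : Matrix (Fin d) (Fin d) A).det‖ ≤ 1 := fun h => by
    rw [Matrix.det_eq_prod_roots_charpoly]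
    exact norm_multiset_prod_le_one _ fun μ hμ =>
      FramedRep.norm_le_one_of_isRoot_charpoly_fu ρ h (Polynomial.isRoot_of_mem_roots hμ)
  have hmul : ((ρ g : GL (Fin d) A) : Matrix (Fin d) (Fin d) A).det *
      ((ρ g⁻¹ : GL (Fin d) A) : Matrix (Fin d) (Fin d) A).det = 1 := by
    rw [← Matrix.det_mul, ← Units.val_mul, ← map_mul, mul_inv_cancel, map_one, Units.val_one, Matrix.det_one]
  have h1 : ‖((ρ g : GL (Fin d) A) : Matrix (Fin d) (Fin d) A).det‖ *
      ‖((ρ g⁻¹ : GL (Fin d) A) : Matrix (Fin d) (Fin d) A).det‖ = 1 := by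
    rw [← norm_mul, hmul, norm_one]
  have ha := hle g
  have hb := hle g⁻¹
  nlinarith [norm_nonneg ((ρ g : GL (Fin d) A) : Matrix (Fin d) (Fin d) A).det,
    norm_nonneg ((ρ g⁻¹ : GL (Fin d) A) : Matrix (Fin d) (Fin d) A).det]

/-- **NEW LEMMA — every eigenvalue of `ρ(g)` is a UNIT (norm exactly `1`)** for a continuous representation of a compact group over an
algebraically closed normed field: all eigenvalues have norm `≤ 1` and their product, the determinant, has norm `1`.  (The tree's
`CompactImageCharpolyIntegral` has the `≤ 1` half only.) Serre 1968 Ch. I §1.1 / §2.3. [folklore] -/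
theorem FramedRep.norm_eq_one_of_isRoot_charpoly (ρ : FramedRep G A d) (g : G) {μ : A}
    (hμ : (FramedRep.charpoly ρ g).IsRoot μ) : ‖μ‖ = 1 := by
  have hle : ∀ x ∈ (FramedRep.charpoly ρ g).roots, ‖x‖ ≤ 1 := fun x hx =>
    FramedRep.norm_le_one_of_isRoot_charpoly_fu ρ g (Polynomial.isRoot_of_mem_roots hx)
  have hne : FramedRep.charpoly ρ g ≠ 0 := (Matrix.charpoly_monic _).ne_zero
  have hmem : μ ∈ (FramedRep.charpoly ρ g).roots := (Polynomial.mem_roots hne).2 hμ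
  obtain ⟨t, ht⟩ := Multiset.exists_cons_of_mem hmem
  have hdet : ‖((ρ g : GL (Fin d) A) : Matrix (Fin d) (Fin d) A).det‖ = ‖μ‖ * ‖t.prod‖ := by
    rw [Matrix.det_eq_prod_roots_charpoly]
    change ‖(FramedRep.charpoly ρ g).roots.prod‖ = _
    rw [ht, Multiset.prod_cons, norm_mul]
  have h1 : ‖μ‖ * ‖t.prod‖ = 1 := by rw [← hdet, FramedRep.norm_det_eq_one]
  have hμ1 : ‖μ‖ ≤ 1 := hle μ hmem
  have ht1 : ‖t.prod‖ ≤ 1 := norm_multiset_prod_le_one t fun x hx => hle x (ht ▸ Multiset.mem_cons_of_mem hx)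
  nlinarith [norm_nonneg μ, norm_nonneg t.prod]

end CompactImage

/-! ### Kernel helpers, II: the dial on special representations (rung engines) and the bridge to g32's algebraicity dial -/

/-- a norm-one element stays norm one under inversion inside the argument: `‖ι'⁻¹(b)‖ = 1 → ‖ι'⁻¹(b⁻¹)‖ = 1`. [folklore] -/
theorem norm_symm_inv_eq_one {ℓ' : ℕ} [Fact ℓ'.Prime] (ι' : PadicAlgCl ℓ' ≃+* ℂ) {b : ℂ} (h : ‖ι'.symm b‖ = 1) : ‖ι'.symm b⁻¹‖ = 1 := by
  rw [map_inv₀, norm_inv, h, inv_one]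

/-- **FU for FINITE-ORDER `ρ`, at EVERY place**: a Frobenius root is a `k`-th root of unity, hence so is each of its avatars, which
therefore has norm `1`. [folklore] -/
theorem hasUnitFrobenius_of_finiteOrder {n : ℕ} (ι : PadicAlgCl ℓ ≃+* ℂ) (ρ : FramedGaloisRep K (PadicAlgCl ℓ) n) {k : ℕ} (hk : 0 < k)
    (hρ : ∀ σ : Field.absoluteGaloisGroup K, ρ σ ^ k = 1) : HasUnitFrobenius K ℓ ι ρ := by
  refine Filter.Eventually.of_forall fun v P hP β hβ ℓ' _ ι' _ => ?_
  obtain ⟨σ, -, hPσ⟩ := exists_eq_charpoly_of_hasFrobCharpolyAt ρ hP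
  have hM : ((ρ σ : GL (Fin n) (PadicAlgCl ℓ)) : Matrix (Fin n) (Fin n) (PadicAlgCl ℓ)) ^ k = 1 := by
    rw [← Units.val_pow_eq_pow_val, hρ σ, Units.val_one]
  rw [hPσ] at hβ
  have hβk : β ^ k = 1 := pow_eq_one_of_mem_roots_charpoly_of_pow_eq_one hM hβ
  have hx : (ι'.symm (ι β)) ^ k = 1 := by rw [← map_pow, ← map_pow, hβk, map_one, map_one]
  have hn : ‖ι'.symm (ι β)‖ ^ k = 1 := by rw [← norm_pow, hx, norm_one]
  exact (pow_eq_one_iff_of_nonneg (norm_nonneg _) hk.ne').1 hn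

/-- **FU for MEMBERS OF FULL COMPATIBLE FAMILIES** («Frobenius eigenvalues in a compatible system are `p`-units»): at `v ∉ S` with `v ∤ ℓ'`,
`ι β` is a root of `ι'(P')` for a Frobenius polynomial `P'` of the `ℓ'`-adic companion `ρ'`, i.e. `ι'⁻¹(ι β)` is an eigenvalue of `ρ'` at a
Frobenius, a unit by `FramedRep.norm_eq_one_of_isRoot_charpoly` (compact Galois group). [folklore] -/
theorem hasUnitFrobenius_of_compatibleFamily {n : ℕ} (ι : PadicAlgCl ℓ ≃+* ℂ) (ρ : FramedGaloisRep K (PadicAlgCl ℓ) n)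
    {S : Set (HeightOneSpectrum (𝓞 K))} (hS : S.Finite)
    (hfam : ∀ (ℓ' : ℕ) [Fact ℓ'.Prime] (ι' : PadicAlgCl ℓ' ≃+* ℂ), ∃ ρ' : FramedGaloisRep K (PadicAlgCl ℓ') n, ∀ v ∉ S,
      ((ℓ' : ℕ) : 𝓞 K) ∉ v.asIdeal → ∀ P : Polynomial (PadicAlgCl ℓ), ρ.HasFrobCharpolyAt v P →
        ∃ P' : Polynomial (PadicAlgCl ℓ'), ρ'.HasFrobCharpolyAt v P' ∧ P'.map (ι' : PadicAlgCl ℓ' →+* ℂ) = P.map (ι : PadicAlgCl ℓ →+* ℂ)) :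
    HasUnitFrobenius K ℓ ι ρ := by
  filter_upwards [hS.compl_mem_cofinite] with v hvS P hP β hβ ℓ' _ ι' hvℓ'
  obtain ⟨ρ', hρ'⟩ := hfam ℓ' ι'
  obtain ⟨P', hP', heq⟩ := hρ' v hvS hvℓ' P hP
  obtain ⟨σ, -, hPσ⟩ := exists_eq_charpoly_of_hasFrobCharpolyAt ρ' hP'
  have hβroot : (P.map (ι : PadicAlgCl ℓ →+* ℂ)).IsRoot (ι β) := (Polynomial.isRoot_of_mem_roots hβ).map
  rw [← heq] at hβroot
  have hroot' : P'.IsRoot (ι'.symm (ι β)) := by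
    refine Polynomial.IsRoot.of_map (f := (ι' : PadicAlgCl ℓ' →+* ℂ)) ?_ (ι' : PadicAlgCl ℓ' →+* ℂ).injective
    have : (ι' : PadicAlgCl ℓ' →+* ℂ) (ι'.symm (ι β)) = ι β := ι'.apply_symm_apply (ι β)
    rw [this]
    exact hβroot
  rw [hPσ] at hroot'
  haveI : CompactSpace (Field.absoluteGaloisGroup K) := absoluteGaloisGroup_compactSpace K
  exact FramedRep.norm_eq_one_of_isRoot_charpoly ρ' σ hroot'

omit [NumberField K] in
/-- a prime of `𝓞 K` does not contain both `2` and `3`. [folklore] -/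
theorem two_not_mem_or_three_not_mem (v : HeightOneSpectrum (𝓞 K)) :
    ((2 : ℕ) : 𝓞 K) ∉ v.asIdeal ∨ ((3 : ℕ) : 𝓞 K) ∉ v.asIdeal := by
  by_contra h
  rw [not_or, not_not, not_not] at h
  have h1 : (1 : 𝓞 K) ∈ v.asIdeal := by
    have h' : ((3 : ℕ) : 𝓞 K) - ((2 : ℕ) : 𝓞 K) ∈ v.asIdeal := v.asIdeal.sub_mem h.2 h.1
    have e : ((3 : ℕ) : 𝓞 K) - ((2 : ℕ) : 𝓞 K) = 1 := by push_cast; norm_num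
    rwa [e] at h'
  exact v.isPrime.ne_top ((Ideal.eq_top_iff_one _).2 h1)

omit [NumberField K] in
/-- **THE UNIT DIAL REFINES THE ALGEBRAICITY DIAL (per representation)**: unit avatars at the single prime `ℓ' ∈ {2, 3}` not under `v`, for
ALL `ι'`, already force `ι β` — hence `β` — to be algebraic (Steinitz: a transcendental can be moved by `Aut ℂ` onto its quotient by `ℓ'`;
tree `LArithmeticOfAutToGal.isAlgebraic_of_forall_norm_symm_le_one`). [folklore] -/
theorem hasAlgebraicFrobenius_of_hasUnitFrobenius {n : ℕ} (ι : PadicAlgCl ℓ ≃+* ℂ) (ρ : FramedGaloisRep K (PadicAlgCl ℓ) n)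
    (h : HasUnitFrobenius K ℓ ι ρ) : HasAlgebraicFrobenius K ℓ ρ := by
  filter_upwards [h] with v hv P hP β hβ
  have key : ∀ (ℓ' : ℕ) [Fact ℓ'.Prime], ((ℓ' : ℕ) : 𝓞 K) ∉ v.asIdeal → IsAlgebraic ℚ β := fun ℓ' _ hℓ' => by
    have halg : IsAlgebraic ℚ (ι β) :=
      Summit.Langlands.Langlands.Theorems.LArithmeticOfAutToGal.isAlgebraic_of_forall_norm_symm_le_one ℓ'
        fun ι' => (hv P hP β hβ ℓ' ι' hℓ').le
    simpa using isAlgebraic_symm ι halg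
  rcases two_not_mem_or_three_not_mem v with h2 | h3
  · haveI : Fact (Nat.Prime 2) := ⟨Nat.prime_two⟩
    exact key 2 h2
  · haveI : Fact (Nat.Prime 3) := ⟨Nat.prime_three⟩
    exact key 3 h3

end Dial

end Summit.Langlands.Langlands.Theorems.FrobeniusUnitCarving
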